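import Mathlib.AlgebraicGeometry.Pullbacks
import Mathlib.AlgebraicGeometry.Morphisms.Flat
import Mathlib.AlgebraicGeometry.Morphisms.FiniteType
import Mathlib.CategoryTheory.Comma.Over.Pullback
import Mathlib.CategoryTheory.HomCongr
import Mathlib.Analysis.Complex.Basic
import Mathlib.Analysis.SpecialFunctions.Trigonometric.Basic
import Mathlib.RingTheory.TensorProduct.Basic
import Mathlib.Algebra.BigOperators.Finprod
import Literature.AlgebraicGeometry.Motives.Varieties
import Literature.AlgebraicGeometry.Motives.AlgPoints
import Literature.AlgebraicGeometry.Motives.Cycles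
import Literature.AlgebraicGeometry.Motives.PreWeilCohomology
import HarnessLib

-- provenance: harness21/H21/H21/Prelude/MotiveL/BaseChange.lean @ 3921232 (interim HEAD d8f2665); M5 mechanical rewrite
/-!
# Base change along a ring homomorphism (trunk MotiveL, prelude C0)

Glue used by every statement involving an embedding `σ : k →+* L` of fields (typically
`σ : k →+* ℂ` for a number field `k`): base change of `k`-schemes along `σ`, the corresponding
identification of `L`-points, conjugate varieties, and the honest pull-back
`W.comap σ : PreWeilCohomology k K` of (the data of) a Weil cohomology theory `W` on `L`-schemes.

## Main definitions

* `Literature.AlongHom L σ`: the type synonym for `L` viewed as a `k`-algebra through `σ : k →+* L`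
  (a `def`, so that `L ⊗_{k,σ} V` and `L ⊗_{k,σ'} V` are different types), with
  `AlongHom.equiv σ : AlongHom L σ ≃+* L`; `Literature.twoPiI σ = 2πi ∈ AlongHom ℂ σ`.
* `Literature.baseChangeHom σ : SchemeOver k ⥤ SchemeOver L`, `X ↦ X_σ = X ×_{Spec k, σ} Spec L`
  (Mathlib `Over.pullback (Spec.map σ)`); it is *definitionally* `Literature.baseChange k L` when
  `σ = algebraMap k L` (`baseChangeHom_algebraMap`). `Literature.baseChangeHomFst σ X : X_σ ⟶ X` is the
  (flat) projection.
* `Literature.AlgPoints.baseChangeEquiv σ X : X(L) ≃ X_σ(L)` (universal property of the fibre product,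
  via Mathlib `Over.mapPullbackAdj`).
* `Literature.conjugateVariety τ X = X^τ` for `τ : L ≃+* L`.
* `Literature.pointsOver σ X z`: the points of `X_σ` over `z ∈ X` of the same codimension, i.e. the generic
  points of the components of `π⁻¹(closure {z})`.
* `Literature.PreWeilCohomology.comap σ W`: the pre-Weil cohomology theory `X ↦ H•(X_σ)` on `k`-schemes.

## Design notes

* Mathlib has `Over.pullback`, `Over.mapPullbackAdj`, `AlgebraicGeometry.Flat` with its
  base-change instances, `Algebra.TensorProduct`, `RingHom.toAlgebra`; it has no type synonym for
  "`L` as a `k`-algebra via `σ`" (searched `AlongHom`, `RestrictScalars` is the module-level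
  analogue in the other direction) and no cohomology theories. Everything here is glue.
* `PreWeilCohomology.comap`: `Hⁱ`, cup, unit and trace are those of `X_σ`; the cycle class of the
  prime cycle `closure {z}` is the sum of the classes of the components of its base change, i.e.
  `∑ᶠ z' ∈ pointsOver σ X z, cl(closure {z'})`. This equals `cl(π^*[z])` exactly when all
  multiplicities are `1`, i.e. when `κ(z) ⊗_k L` is reduced (EGA IV 4.6.1; Fulton, *Intersection
  Theory*, Ex. 6.1.2), in particular whenever `k` is perfect (e.g. `char k = 0`), which covers every
  use in H21. The general-multiplicity version is `W.cycleMap X_σ p` of the flat pull-back of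
  `primeCycle z` (prelude `SubschemeCycles`, `AlgebraicCycle.baseChange`); the two are compared in
  `Statements/Hodge/CyclesEquivalences`. The `finsum` has junk value `0` if `pointsOver σ X z` is
  infinite (it is finite for `X` locally of finite type, `finite_pointsOver`).
* No `WeilCohomology.comap` is provided: its axioms would need descent of `IsSmoothProjective`
  along `σ`; comparisons are stated at the `PreWeilCohomology` level.
* Imports: `Mathlib.RingTheory.TensorProduct.Basic` is not used in this file but is re-exported
  on purpose, since downstream statements form `AlongHom L σ ⊗[k] V` (Deligne's `V ⊗_{k,σ} ℂ`);
  `Literature.Prelude.MotiveAbstract.Cycles` is a listed dependency (transitively imported anyway).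
  `Complex.two_pi_I_ne_zero` lives in `SpecialFunctions.Complex.Log`, which we do not import;
  `isUnit_twoPiI` is proved directly.

## References

* A. Grothendieck, EGA IV₂ §4.6 (geometric reducedness), EGA I §3.3 (base change).
* R. Hartshorne, *Algebraic Geometry*, II.3 (fibre products, base extension), II Ex. 2.7.
* W. Fulton, *Intersection Theory*, §1.7 and Ex. 6.1.2 (flat pull-back, exterior products).
* P. Deligne, *Hodge cycles on abelian varieties* (1982), §1 (`σ`-conjugates, `2πi`).
* J.-P. Serre, *Exemples de variétés projectives conjuguées non homéomorphes*, C. R. Acad. Sci.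
  258 (1964) (conjugate varieties).
-/

universe u v

open CategoryTheory AlgebraicGeometry Limits Opposite

noncomputable section

namespace Literature.AlgebraicGeometry.Motives

/-! ### `L` as a `k`-algebra along `σ` -/

/-- `AlongHom L σ` is the ring `L` regarded as a `k`-algebra through the ring homomorphism
`σ : k →+* L` (so that `algebraMap k (AlongHom L σ) = σ`). A `def` (not an `abbrev`), so that
tensor products `AlongHom L σ ⊗[k] V` along different embeddings are different types
(Deligne 1982, §1: `V ⊗_{k,σ} ℂ`). [cite: Deligne1982, §1:  V ⊗_{k σ} ℂ] -/
@[nolint unusedArguments]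
def AlongHom {k : Type*} (L : Type*) [CommRing k] [CommRing L] (_σ : k →+* L) : Type _ := L

namespace AlongHom

variable {k L : Type*} [CommRing k] [CommRing L] (σ : k →+* L)

/-- `AlongHom L σ` is the commutative ring `L` (Deligne 1982, §1). [cite: Deligne1982, §1] -/
instance instCommRing : CommRing (AlongHom L σ) := inferInstanceAs (CommRing L)

/-- `AlongHom L σ` is a `k`-algebra via `σ` (Mathlib `RingHom.toAlgebra`; Deligne 1982, §1). [cite: Deligne1982, §1] -/
instance instAlgebra : Algebra k (AlongHom L σ) := σ.toAlgebra

/-- The identity ring isomorphism `AlongHom L σ ≃+* L` (forgetting the `k`-algebra structure;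
Deligne 1982, §1). [cite: Deligne1982, §1] -/
def equiv : AlongHom L σ ≃+* L := RingEquiv.refl L

/-- The structure map of `AlongHom L σ` is `σ` (by construction, `RingHom.algebraMap_toAlgebra`). [folklore] -/
@[simp]
theorem equiv_algebraMap (x : k) : equiv σ (algebraMap k (AlongHom L σ) x) = σ x := rfl

/-- The structure map of `AlongHom L σ` is `σ`, stated with `equiv.symm`
(`RingHom.algebraMap_toAlgebra`). [folklore] -/
theorem algebraMap_apply (x : k) : algebraMap k (AlongHom L σ) x = (equiv σ).symm (σ x) := rfl

end AlongHom

namespace AlongHom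

variable {k L : Type*} [CommRing k] [Field L] (σ : k →+* L)

/-- `AlongHom L σ` is the field `L` (Deligne 1982, §1). [cite: Deligne1982, §1] -/
instance instField : Field (AlongHom L σ) := inferInstanceAs (Field L)

/-- `AlongHom L σ` has characteristic zero when `L` does (Deligne 1982, §1). [cite: Deligne1982, §1] -/
instance instCharZero [CharZero L] : CharZero (AlongHom L σ) := inferInstanceAs (CharZero L)

end AlongHom

/-- The period `2πi ∈ ℂ`, as an element of `ℂ` regarded as a `k`-algebra along `σ : k →+* ℂ`
(Deligne 1982, §1: the comparison of trace maps is off by `(2πi)ⁿ`). [cite: Deligne1982, §1: the comparison of trace maps is off] -/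
def twoPiI {k : Type*} [CommRing k] (σ : k →+* ℂ) : AlongHom ℂ σ :=
  (AlongHom.equiv σ).symm (2 * Real.pi * Complex.I)

/-- `2πi` is a unit (it is nonzero in the field `ℂ`; Deligne 1982, §1). [cite: Deligne1982, §1] -/
theorem isUnit_twoPiI {k : Type*} [CommRing k] (σ : k →+* ℂ) : IsUnit (twoPiI σ) := by
  refine (isUnit_iff_ne_zero.mpr ?_).map (AlongHom.equiv σ).symm
  simp [Real.pi_ne_zero, Complex.I_ne_zero]

/-! ### Base change of `k`-schemes along `σ : k →+* L` -/

section BaseChange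

variable {k L : Type u} [CommRing k] [CommRing L]

/-- Base change of `k`-schemes along a ring homomorphism `σ : k →+* L`:
`X ↦ X_σ = X ×_{Spec k, Spec σ} Spec L`, as the pullback functor `Over (Spec k) ⥤ Over (Spec L)`
(Hartshorne II.3, "base extension"; EGA I 3.3). For `σ = algebraMap k L` this is
`Literature.baseChange k L`, definitionally (`baseChangeHom_algebraMap`). [folklore] -/
def baseChangeHom (σ : k →+* L) : SchemeOver k ⥤ SchemeOver L :=
  Over.pullback (Spec.map (CommRingCat.ofHom σ))

/-- Base change along the structure map of an algebra is `Literature.AlgebraicGeometry.Motives.baseChange` (by `rfl`). [folklore] -/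
theorem baseChangeHom_algebraMap [Algebra k L] :
    baseChangeHom (algebraMap k L) = baseChange k L := rfl

/-- The projection `π : X_σ ⟶ X` on underlying schemes (first projection of the fibre product;
Hartshorne II.3). [folklore] -/
def baseChangeHomFst (σ : k →+* L) (X : SchemeOver k) :
    ((baseChangeHom σ).obj X).left ⟶ X.left :=
  pullback.fst X.hom (Spec.map (CommRingCat.ofHom σ))

/-- The underlying scheme of `X_σ` is the fibre product `X ×_{Spec k} Spec L` (by `rfl`;
Mathlib `Over.pullback_obj_left`). [folklore] -/
theorem baseChangeHom_obj_left (σ : k →+* L) (X : SchemeOver k) :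
    ((baseChangeHom σ).obj X).left = pullback X.hom (Spec.map (CommRingCat.ofHom σ)) := rfl

/-- The structure map of `X_σ` is the second projection `X ×_{Spec k} Spec L ⟶ Spec L` (by `rfl`;
Mathlib `Over.pullback_obj_hom`). [folklore] -/
theorem baseChangeHom_obj_hom (σ : k →+* L) (X : SchemeOver k) :
    ((baseChangeHom σ).obj X).hom = pullback.snd X.hom (Spec.map (CommRingCat.ofHom σ)) := rfl

/-- `π : X_σ ⟶ X` commutes with the maps induced by a `k`-morphism `f : X ⟶ Y`
(naturality of the first projection; Mathlib `Over.pullback_map_left`). [folklore] -/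
@[reassoc]
theorem baseChangeHom_map_left_comp_fst (σ : k →+* L) {X Y : SchemeOver k} (f : X ⟶ Y) :
    ((baseChangeHom σ).map f).left ≫ baseChangeHomFst σ Y = baseChangeHomFst σ X ≫ f.left :=
  pullback.lift_fst _ _ _

end BaseChange

section Field

variable {k L : Type u} [Field k] [CommRing L] (σ : k →+* L) (X : SchemeOver k)

/-- The projection `π : X_σ ⟶ X` is flat: it is the base change of `Spec L ⟶ Spec k`, which is
flat since `k` is a field (EGA IV 2.1.4; Hartshorne III.9.2). [folklore] -/
instance : Flat (baseChangeHomFst σ X) :=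
  MorphismProperty.pullback_fst _ _ inferInstance

end Field

section Fields

variable {k L : Type u} [Field k] [Field L]

/-- Smooth projective varieties are stable under base change along a homomorphism of fields
(Hartshorne III.10.1(b), II.4.8(c); Stacks 038F, 01WF). Reduced to
`IsSmoothProjective.baseChange` via `baseChangeHom_algebraMap`. [folklore] -/
def IsSmoothProjective.baseChangeHom : Prop :=
  ∀ (σ : k →+* L) {n : ℕ} {X : SchemeOver k} (h : IsSmoothProjective n X),
    IsSmoothProjective n ((Literature.AlgebraicGeometry.Motives.baseChangeHom σ).obj X)

/- interim proof relied on results that are now named facts (D-0014); demoted to a fact by the M5 import, proof preserved: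
:=
  letI := σ.toAlgebra
  h.baseChange L
-/

end Fields

/-! ### `L`-points and base change -/

namespace AlgPoints

variable {k L : Type u} [Field k] [Field L] (σ : k →+* L) (X : SchemeOver k)

/-- `Spec L` over `Spec k` via `σ` is `Spec L` over itself pushed forward along `Spec σ`
(the identity on underlying schemes; Hartshorne II Ex. 2.7). Auxiliary for `baseChangeEquiv`. [folklore] -/
def specOverIsoMapObj :
    (letI := σ.toAlgebra; specOver k L) ≅
      (Over.map (Spec.map (CommRingCat.ofHom σ))).obj (specOver L L) :=
  Over.isoMk (Iso.refl _) (by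
    letI := σ.toAlgebra
    simp only [Over.map_obj_left, Iso.refl_hom, Over.map_obj_hom, Over.mk_hom,
      Algebra.algebraMap_self, CommRingCat.ofHom_id, Spec.map_id]
    rfl)

/-- `L`-points of `X` over `k` (with `L` a `k`-algebra via `σ`) are the same as `L`-points of the
base change `X_σ` over `L`: `X(L) ≃ X_σ(L)`, by the universal property of the fibre product
`X_σ = X ×_{Spec k} Spec L` (Mathlib `Over.mapPullbackAdj`; Hartshorne II.3, Thm. 3.3 and
II Ex. 2.7). [folklore] -/
def baseChangeEquiv :
    (letI := σ.toAlgebra; AlgPoints X L) ≃ AlgPoints ((baseChangeHom σ).obj X) L :=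
  ((specOverIsoMapObj σ).homCongr (Iso.refl X)).trans
    ((Over.mapPullbackAdj (Spec.map (CommRingCat.ofHom σ))).homEquiv (specOver L L) X)

/-- The inverse of `baseChangeEquiv` is composition with `π : X_σ ⟶ X` on underlying schemes
(Hartshorne II.3, Thm. 3.3). [folklore] -/
@[simp]
theorem baseChangeEquiv_symm_apply_left (Q : AlgPoints ((baseChangeHom σ).obj X) L) :
    (letI := σ.toAlgebra; ((baseChangeEquiv σ X).symm Q).left) =
      Q.left ≫ baseChangeHomFst σ X := by
  simp only [baseChangeEquiv, Equiv.symm_trans_apply, Iso.homCongr_symm, Iso.homCongr_apply,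
    Iso.refl_hom, Over.comp_left, specOverIsoMapObj, Iso.symm_inv, Over.isoMk_hom_left]
  rfl

/-- The point of `X_σ(L)` attached to `P ∈ X(L)` lies over `P`: composing with `π : X_σ ⟶ X`
recovers `P` (Hartshorne II.3, Thm. 3.3). [folklore] -/
@[simp]
theorem baseChangeEquiv_apply_left_comp_fst (P : letI := σ.toAlgebra; AlgPoints X L) :
    (baseChangeEquiv σ X P).left ≫ baseChangeHomFst σ X = P.left := by
  rw [← baseChangeEquiv_symm_apply_left, Equiv.symm_apply_apply]

/-- `X(L) ≃ X_σ(L)` is a homeomorphism for the strong topologies attached to a Hausdorff field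
topology on `L` (Mumford, *Red Book*, I.10; Serre, GAGA §2; Conrad, *Weil and Grothendieck
approaches to adelic points*, Prop. 2.1). The hypotheses `[IsTopologicalDivisionRing L]
[T2Space L]` are needed, exactly as in `AlgPoints.isHomeomorph_prodEquiv`: regular functions on
`X_σ` are locally of the form `∑ aᵢ fᵢ` and `h / gⁿ` in pull-backs of regular functions on `X`,
so continuity of `X(L) → X_σ(L)` uses continuity of `+`, `·`, `⁻¹` and closedness of `{0}`;
for, say, the indiscrete topology on `L = ℂ` and `X = 𝔸¹_ℚ` the Zariski-open
`(𝔸¹_ℂ ∖ {π})(ℂ)` is open in `X_σ(ℂ)` but not in `X(ℂ)`. Source: the base-change identification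
`X(R) → X(R') = X'(R')` is Conrad, Ex. 2.2 (affine finite type: "immediate from the
construction" of Prop. 2.1) and, beyond the affine case, rests on Prop. 3.1 (locally finite type
`R`-schemes, `R` with `Rˣ` open and continuous inversion). NOTE: Conrad assumes `X` (locally) of
finite type throughout; this fact quantifies over every `X : SchemeOver k` because the tree's
`AlgPoints.instTopologicalSpace` is the strong topology generated by the basic sets
`{P ∈ U(L) | f(P) ∈ V}` (all opens `U`, regular `f`, open `V ⊆ L`) on an ARBITRARY scheme, for
which the same transport-of-structure argument is meant — the finite-type hypothesis of the source
is deliberately dropped, so a discharge `isHomeomorph_baseChangeEquiv_holds` must prove the general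
case and not just quote the source.
[cite: ConradAdelicPoints2012, Ex. 2.2 and Prop. 3.1] -/
def isHomeomorph_baseChangeEquiv : Prop :=
  ∀ [TopologicalSpace L] [IsTopologicalDivisionRing L] [T2Space L],
    IsHomeomorph (baseChangeEquiv σ X :
      (letI := σ.toAlgebra; AlgPoints X L) → AlgPoints ((baseChangeHom σ).obj X) L)

end AlgPoints

/-- The *conjugate* `X^τ` of an `L`-scheme `X` by a field automorphism `τ : L ≃+* L`.
**Convention:** `X^τ := X ×_{Spec L, Spec τ} Spec L`, the base change of `X` along `τ` itself
(not `τ⁻¹`), so that `X^τ(L) ≃ X(AlongHom L τ)` (`AlgPoints.baseChangeEquiv τ`); if `X` is cut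
out by equations `fⱼ`, then `X^τ` is cut out by the `τ(fⱼ)`. Deligne's `σX` for `σ ∈ Aut ℂ`
(Deligne 1982, §1) is `conjugateVariety σ X`; Serre 1964 uses the same convention. Downstream
statements (MotiveL C5/C9/C11) follow this choice. [cite: Deligne1982, §1] -/
def conjugateVariety {L : Type u} [Field L] (τ : L ≃+* L) (X : SchemeOver L) : SchemeOver L :=
  (baseChangeHom τ.toRingHom).obj X

/-- `X^τ` is `(baseChangeHom τ).obj X` (by `rfl`; unfolding lemma). [folklore] -/
@[simp]
theorem conjugateVariety_eq {L : Type u} [Field L] (τ : L ≃+* L) (X : SchemeOver L) :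
    conjugateVariety τ X = (baseChangeHom τ.toRingHom).obj X := rfl

/-- The conjugate of a smooth projective variety is smooth projective of the same dimension
(base change along a field automorphism; Hartshorne III.10.1(b)). [folklore] -/
def IsSmoothProjective.conjugateVariety : Prop :=
  ∀ {L : Type u} [Field L] (τ : L ≃+* L) {n : ℕ} {X : SchemeOver L} (h : IsSmoothProjective n X),
    IsSmoothProjective n (Literature.AlgebraicGeometry.Motives.conjugateVariety τ X)

/- interim proof relied on results that are now named facts (D-0014); demoted to a fact by the M5 import, proof preserved:
:=
  h.baseChangeHom τ.toRingHom
-/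

/-! ### Cohomology along `σ` -/

section PointsOver

variable {k L : Type u} [Field k] [Field L] (σ : k →+* L) (X : SchemeOver k)

/-- The points of `X_σ` lying over `z ∈ X` and of the same codimension as `z`: these are the
generic points of the irreducible components of `π⁻¹(closure {z}) = closure {z} ×_k Spec L`
(EGA IV 4.4; Fulton, *Intersection Theory*, §1.7). The codimension condition is needed because
closed points of `X_σ` may lie over non-closed points of `X`. [folklore] -/
def pointsOver (z : X.left) : Set ↥((baseChangeHom σ).obj X).left :=
  {z' | (baseChangeHomFst σ X).base z' = z ∧ Order.coheight z' = Order.coheight z}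

variable {σ X} in
/-- Membership in `pointsOver σ X z`, unfolded. [folklore] -/
@[simp]
theorem mem_pointsOver_iff {z : X.left} {z' : ↥((baseChangeHom σ).obj X).left} :
    z' ∈ pointsOver σ X z ↔
      (baseChangeHomFst σ X).base z' = z ∧ Order.coheight z' = Order.coheight z :=
  Iff.rfl

/-- For `X` locally of finite type over `k`, only finitely many points of `X_σ` of the same
codimension lie over a given `z ∈ X`: `closure {z} ×_k L` is a Noetherian scheme and these are the
generic points of its irreducible components (EGA IV 4.4.1, 4.5; Stacks 04KV, 0BA8).
[cite: EGAIV2, (4.4.1) and §4.5] -/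
def finite_pointsOver : Prop :=
  ∀ [LocallyOfFiniteType X.hom] (z : X.left),
    (pointsOver σ X z).Finite

end PointsOver

namespace PreWeilCohomology

variable {k L : Type u} [Field k] [Field L] {K : Type v} [Field K]

/-- Pull-back of (the data of) a Weil cohomology theory on `L`-schemes along `σ : k →+* L`:
the theory `X ↦ H•(X_σ)` on `k`-schemes, with the cup products, unit and trace of `X_σ`, and with
cycle class of the prime cycle `closure {z}` the sum `∑ᶠ z' ∈ pointsOver σ X z, cl(closure {z'})`
of the classes of the components of `closure {z} ×_k L`. This is the class of the flat pull-back
`π^*[closure {z}]` exactly when `κ(z) ⊗_k L` is reduced (all multiplicities `1`; EGA IV 4.6.1,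
Fulton Ex. 6.1.2), e.g. for `k` perfect, in particular in characteristic `0` — every use in H21.
The `finsum` is `0` (junk) on infinite support; see `finite_pointsOver`. Example: Betti cohomology
of `X(ℂ)` for `X/k` and `σ : k →+* ℂ` is `(Betti).comap σ` (Deligne 1982, §1). [cite: Deligne1982, §1] -/
def comap (σ : k →+* L) (W : PreWeilCohomology L K) : PreWeilCohomology k K where
  H i := (baseChangeHom σ).op ⋙ W.H i
  cup h := W.cup h
  one X := W.one ((baseChangeHom σ).obj X)
  trace X n := W.trace ((baseChangeHom σ).obj X) n
  cycleClass X p z := ∑ᶠ z' ∈ pointsOver σ X z, W.cycleClass ((baseChangeHom σ).obj X) p z'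

variable (σ : k →+* L) (W : PreWeilCohomology L K) (X : SchemeOver k)

/-- `Hⁱ` of `W.comap σ` on `X` is `Hⁱ(X_σ)` (by `rfl`). [folklore] -/
@[simp]
theorem comap_obj (i : ℕ) : (W.comap σ).obj X i = W.obj ((baseChangeHom σ).obj X) i := rfl

/-- Pull-back in `W.comap σ` along `f` is pull-back in `W` along `f_σ` (by `rfl`). [folklore] -/
@[simp]
theorem comap_pullback {X Y : SchemeOver k} (f : X ⟶ Y) (i : ℕ) :
    (W.comap σ).pullback f i = W.pullback ((baseChangeHom σ).map f) i := rfl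

/-- The cup product of `W.comap σ` on `X` is that of `W` on `X_σ` (by `rfl`). [folklore] -/
@[simp]
theorem comap_cup {i j n : ℕ} (h : i + j = n) :
    (W.comap σ).cup (X := X) h = W.cup (X := (baseChangeHom σ).obj X) h := rfl

/-- The unit of `W.comap σ` on `X` is that of `W` on `X_σ` (by `rfl`). [folklore] -/
@[simp]
theorem comap_one : (W.comap σ).one X = W.one ((baseChangeHom σ).obj X) := rfl

/-- The trace of `W.comap σ` on `X` is that of `W` on `X_σ` (by `rfl`). [folklore] -/
@[simp]
theorem comap_trace (n : ℕ) : (W.comap σ).trace X n = W.trace ((baseChangeHom σ).obj X) n := rfl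

/-- The cycle class of `closure {z}` in `W.comap σ` is the sum of the classes in `W` of the
components of `closure {z} ×_k L` (by `rfl`; see `comap` for the multiplicity caveat). [folklore] -/
theorem comap_cycleClass (p : ℕ) (z : X.left) :
    (W.comap σ).cycleClass X p z =
      ∑ᶠ z' ∈ pointsOver σ X z, W.cycleClass ((baseChangeHom σ).obj X) p z' := rfl

/-- The algebraic lattice of `W.comap σ` on `X` is contained in that of `W` on `X_σ`: each
generator is a finite (or junk-zero) sum of classes of codimension-`p` points of `X_σ`
(Kleiman 1968, §1.2 (C)). [cite: Kleiman1968, §1.2 (C] -/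
theorem comap_algebraicLattice_le (p : ℕ) :
    (W.comap σ).algebraicLattice X p ≤ W.algebraicLattice ((baseChangeHom σ).obj X) p := by
  refine (AddSubgroup.closure_le _).mpr ?_
  rintro _ ⟨⟨z, hz⟩, rfl⟩
  change ∑ᶠ z' ∈ pointsOver σ X z, W.cycleClass ((baseChangeHom σ).obj X) p z' ∈ _
  refine finsum_mem_induction (· ∈ W.algebraicLattice ((baseChangeHom σ).obj X) p) (zero_mem _)
    (fun _ _ hx hy ↦ add_mem hx hy) fun z' hz' ↦ ?_
  exact W.cycleClass_mem_algebraicLattice _ p (hz'.2.trans hz)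

/-- The `K`-span of algebraic classes of `W.comap σ` on `X` is contained in that of `W` on `X_σ`
(base change of algebraic cycles are algebraic; Kleiman 1968, §1.2 (C)). [cite: Kleiman1968, §1.2 (C] -/
theorem comap_algebraicClasses_le (p : ℕ) :
    (W.comap σ).algebraicClasses X p ≤ W.algebraicClasses ((baseChangeHom σ).obj X) p :=
  Submodule.span_mono (W.comap_algebraicLattice_le σ X p)

end PreWeilCohomology

end Literature.AlgebraicGeometry.Motives

end
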